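import Mathlib
import HarnessLib
import Summits.HubbardSuperconductivity.HubbardSuperconductivity.Theorems.KLProgrammeKLRegimeSplitPhValueModuli
import Summits.HubbardSuperconductivity.HubbardSuperconductivity.Theorems.KLProgrammeKLRegimeSplitEdgeFactsWindowedMass

/-!
# Route `KLProgramme` — ENGINE (stmt-HubbardSuperconductivity-20437 `KLRegimeEngineV17F2`), row (c) binder #8 (★ v19 `hexLadMV`), value rows `RP/RQ`: the MODULI part with a
# PINNING PROFILE — the kernels' shell variation charged through WINDOW MASSES, `δ(k̃) = ε + Σ_w 𝟙[‖k̃ − cen_w‖_𝕋 ≤ ρ_w]·A_w` ⇒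
# `2¹⁰·15367·ε + Σ_w 2¹⁰·15381·(ρ_w/π + 1/L)·A_w` — brick O6e′ (the (F1) «corner counting» interface of E1-LEDGER rev 14 §17 in the closer's currency)
# (cell gate-hubbard-kl, seat hubbard-kl-k3c2-p2 g32, technique «thermal-bar induction n ≤ nScales β + 1 with EngineBoundsAtV4S sums»)

WHY.  O6e (`klph_phValue_row_moduli_le`) charges the moduli part through ONE number `δ = sup` over the whole hard shell; by value that number must absorb the kernels' variation at
the crossed-channel CORNERS (`θ_p ≈ θ_x + π` pp / `θ_p ≈ θ_y` ph-forward), where it is `O(c₄U·U²N0)` — n-flat.  The corner law (`≍ c₄U³N0Λ(2 + n ln4)`, p1 g28 / T2-2 g25) is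
realised when the variation is charged WHERE it sits: the corners ARE momentum windows (`‖k̃ + x‖_𝕋 ≤ η`, `‖k̃ − y‖_𝕋 ≤ η` — no geometry), and the hard-line × soft-line mass of a
window is `∝ (ρ/π + 1/L)` (`sum_window_softSymbol_mul_norm_propCT_le`, EdgeFacts).  So this file replaces the constant `δ` by the θ-package's PINNING PROFILE
`δ(k̃) = ε + Σ_{w < m} 𝟙[‖k̃ − cen w‖_𝕋 ≤ ρ w]·A w` (nested dyadic windows `ρ_j = 2^jΛ`, `A_j ≍ c₄U³N0·2^{−j}` give `Σ_j 2^jΛ·A_j ≍ c₄U³N0Λ·(#levels)` = the corner law,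
the `1/L` tails go to the volume share):

* `klph_sum_window_bornLines_norm_le` — WINDOW mass of the born line pair: `(Λₙ−Λₙ₊₁)((βL²)³)⁻¹·Σ_{p : ‖k̃_p − cen‖_𝕋 ≤ ρ} ‖Ẇ_tβL²ĝ‖·‖Φ_jβL²ĝ‖ ≤ 2⁹·15381·(ρ/π + 1/L)`;
* **`klph_phValue_row_profile_le`** — for any kernel product `W`, `p`-independent `V₀`, and a profile `(ε; cen, ρ, A : Fin m → …)` with
  `‖W p σ − V₀ σ‖ ≤ ε + Σ_w 𝟙[‖k̃_p − cen w‖_𝕋 ≤ ρ w]·A w` wherever `Ẇ_t(p) ≠ 0`: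
  `(Λₙ−Λₙ₊₁)((βL²)³)⁻¹‖Σ_pΣ_σ(Ẇ_tβL²ĝ)(Φ_jβL²ĝ)·W p σ‖ ≤ (Λₙ−Λₙ₊₁)((βL²)³)⁻¹‖Σ_pΣ_σ(Ẇ_tβL²ĝ)(Φ_jβL²ĝ)·V₀ σ‖ + 2¹⁰·15367·ε + Σ_w 2¹⁰·15381·(ρ w/π + 1/L)·A w`.
(The θ-RESOLVED frozen product `V₀(ϑ)` — rotation null per FS angle — is the separate brick O6i; here `V₀` is still one value.)  Pure composition over landed rows; no definitions;
nothing asserts (c), K3 or superconductivity.  [cite: BenfattoGiulianiMastropietro2006, §2.4–§2.5]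
-/

noncomputable section

namespace Summit.HubbardSuperconductivity.HubbardSuperconductivity.Theorems.KLRegimeSplit

set_option linter.dupNamespace false -- summit = problem name (single-conjunct summit), D-0017

open Real Set Finset Literature.MathematicalPhysics.QuantumLattice
open Literature.Probability.LatticeModels hiding torusSupNorm
open Summit.HubbardSuperconductivity.HubbardSuperconductivity.Theorems.TwoPointAssembly
open Summit.HubbardSuperconductivity.HubbardSuperconductivity.Theorems.KLProgrammeLegKernels
open Summit.HubbardSuperconductivity.HubbardSuperconductivity.Theorems.KLRegimeWick
open Summit.HubbardSuperconductivity.HubbardSuperconductivity.Theorems.EngineV8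
open Summit.HubbardSuperconductivity.HubbardSuperconductivity.Theorems.DispersionFlow

variable {L M : ℕ} [NeZero L] [NeZero M]

section Profile

variable {R : RenConsts} {U : ℝ} {N : ℕ}

omit [NeZero M] in
/-- Slice arithmetic: `(Λₙ − Λₙ₊₁)·Λₙ/Λ(t)² ≤ 12` for `Λ(t) ∈ [Λₙ₊₁, Λₙ]`. -/
private theorem klpf_slice_ratio_le (n : ℕ) {t : ℝ} (ht : t ∈ Icc (0 : ℝ) 1) :
    (klScale klE0 n - klScale klE0 (n + 1)) * klScale klE0 n / (klScale klE0 n + t * (klScale klE0 (n + 1) - klScale klE0 n)) ^ 2 ≤ 12 := by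
  have h10 := (klmf_klScale_succ_pos_le n).2
  have h1 := (klmf_klScale_succ_pos_le n).1
  have hΛn : 0 < klScale klE0 n := klth_klScale_pos n
  have hsucc : klScale klE0 (n + 1) = klScale klE0 n / 4 := klth_klScale_succ n
  have hmem := klws_affine_mem_Icc h10 ht
  calc (klScale klE0 n - klScale klE0 (n + 1)) * klScale klE0 n / (klScale klE0 n + t * (klScale klE0 (n + 1) - klScale klE0 n)) ^ 2
      ≤ (klScale klE0 n - klScale klE0 (n + 1)) * klScale klE0 n / (klScale klE0 (n + 1)) ^ 2 :=
        div_le_div_of_nonneg_left (by nlinarith) (by positivity) (pow_le_pow_left₀ h1.le hmem.1 2)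
    _ = 12 := by rw [hsucc]; field_simp; ring

omit [NeZero M] in
/-- **WINDOW mass of the born line pair**: on an admissible frame (`FrameOK`), `klBetaMin ≤ β ≤ L`, `j ≥ n+1`, `t ∈ [0,1]`, centre `cen`, radius `ρ ≥ 0`:
`(Λₙ−Λₙ₊₁)((βL²)³)⁻¹·Σ_{p : ‖k̃_p − cen‖_𝕋 ≤ ρ} ‖Ẇ_t(p)·βL²ĝ_p‖·‖Φ_j(t)(p)·βL²ĝ_p‖ ≤ 2⁹·15381·(ρ/π + 1/L)` (hard line `(128/3)/Λ(t)²`, WINDOWED soft sum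
`15381(ρ/π + 1/L)ΛₙβL²`, slice ratio `≤ 12`). -/
theorem klph_sum_window_bornLines_norm_le {β μ : ℝ} {K : TrigPolyC4v} (hK : FrameOK R U N μ K) (hβ : klBetaMin ≤ β) (hβL : β ≤ L) (n : ℕ) {t : ℝ}
    (ht : t ∈ Icc (0 : ℝ) 1)
    (Φ : ℕ → ℝ → FreqMomentum L M → ℝ)
    (hΦ : Φ = fun j t k => (softSymbolCompl L M β μ K (n + 1) j) k + (hubbardCutoffWeightCT L M β μ K (klScale klE0 (n + 1)) k -
        hubbardCutoffWeightCT L M β μ K (klScale klE0 n + t * (klScale klE0 (n + 1) - klScale klE0 n)) k))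
    (Wd : ℝ → FreqMomentum L M → ℝ)
    (hWd : Wd = fun t k => deriv (fun Λ' : ℝ => hubbardCutoffWeightCT L M β μ K Λ' k) (klScale klE0 n + t * (klScale klE0 (n + 1) - klScale klE0 n)))
    {j : ℕ} (hj : n + 1 ≤ j) (cen : TorusSite 2 L) {ρ : ℝ} (hρ : 0 ≤ ρ) :
    (klScale klE0 n - klScale klE0 (n + 1)) * ((β * (L : ℝ) ^ 2) ^ 3)⁻¹ *
        ∑ p ∈ (univ : Finset (FreqMomentum L M)).filter (fun p => klTorusNorm L (p.2 - cen) ≤ ρ),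
          ‖((((Wd t p) : ℝ) : ℂ) * (((β * (L : ℝ) ^ 2 : ℝ) : ℂ) * propCT L M β μ K p))‖ *
            ‖((((Φ j t p) : ℝ) : ℂ) * (((β * (L : ℝ) ^ 2 : ℝ) : ℂ) * propCT L M β μ K p))‖ ≤ (2 : ℝ) ^ 9 * 15381 * (ρ / π + ((L : ℝ))⁻¹) := by
  have hβ0 : 0 < β := pos_of_klBetaMin_le hβ
  have hL : (0 : ℝ) < L := hβ0.trans_le hβL
  have hβL2 : 0 < β * (L : ℝ) ^ 2 := by positivity
  have hΛn : 0 < klScale klE0 n := klth_klScale_pos n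
  have h10 := (klmf_klScale_succ_pos_le n).2
  have h1 := (klmf_klScale_succ_pos_le n).1
  have hmem := klws_affine_mem_Icc h10 ht
  set Λt : ℝ := klScale klE0 n + t * (klScale klE0 (n + 1) - klScale klE0 n) with hΛt_def
  have hΛt : 0 < Λt := h1.trans_le hmem.1
  have hdiff : 0 ≤ klScale klE0 n - klScale klE0 (n + 1) := by linarith
  have hΦmem : ∀ k, 0 ≤ Φ j t k ∧ Φ j t k ≤ 1 - hubbardCutoffWeightCT L M β μ K (klScale klE0 n) k := by
    intro k
    have h := klmf_runningSymbol_mem L M β μ K n (isSoftSymbol_compl (L := L) (M := M) β μ K hj).1 ht k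
    rw [hΦ]; exact h
  have hS := sum_window_softSymbol_mul_norm_propCT_le β μ K hK hβ hβL n hΦmem cen hρ
  have hhard : ∀ p : FreqMomentum L M, |Wd t p| * ‖propCT L M β μ K p‖ ≤ 128 / 3 / Λt ^ 2 := by
    intro p; rw [hWd]; exact abs_derivWeight_mul_norm_propCT_le β μ K hΛt p
  have hpt : ∀ p : FreqMomentum L M,
      ‖((((Wd t p) : ℝ) : ℂ) * (((β * (L : ℝ) ^ 2 : ℝ) : ℂ) * propCT L M β μ K p))‖ *
          ‖((((Φ j t p) : ℝ) : ℂ) * (((β * (L : ℝ) ^ 2 : ℝ) : ℂ) * propCT L M β μ K p))‖ ≤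
        (β * (L : ℝ) ^ 2) ^ 2 * (128 / 3 / Λt ^ 2) * (|Φ j t p| * ‖propCT L M β μ K p‖) := by
    intro p
    rw [klph_norm_bornLines_eq hβL2 μ K (Wd t p) (Φ j t p) p]
    have hB : 0 ≤ |Φ j t p| * ‖propCT L M β μ K p‖ := by positivity
    have h2 : 0 ≤ (β * (L : ℝ) ^ 2) ^ 2 := by positivity
    have h3 : (|Wd t p| * ‖propCT L M β μ K p‖) * (|Φ j t p| * ‖propCT L M β μ K p‖) ≤
        (128 / 3 / Λt ^ 2) * (|Φ j t p| * ‖propCT L M β μ K p‖) := mul_le_mul_of_nonneg_right (hhard p) hB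
    calc (β * (L : ℝ) ^ 2) ^ 2 * ((|Wd t p| * ‖propCT L M β μ K p‖) * (|Φ j t p| * ‖propCT L M β μ K p‖))
        ≤ (β * (L : ℝ) ^ 2) ^ 2 * ((128 / 3 / Λt ^ 2) * (|Φ j t p| * ‖propCT L M β μ K p‖)) := mul_le_mul_of_nonneg_left h3 h2
      _ = _ := by ring
  set Wn := (univ : Finset (FreqMomentum L M)).filter (fun p => klTorusNorm L (p.2 - cen) ≤ ρ) with hWn
  calc (klScale klE0 n - klScale klE0 (n + 1)) * ((β * (L : ℝ) ^ 2) ^ 3)⁻¹ *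
        ∑ p ∈ Wn, ‖((((Wd t p) : ℝ) : ℂ) * (((β * (L : ℝ) ^ 2 : ℝ) : ℂ) * propCT L M β μ K p))‖ *
          ‖((((Φ j t p) : ℝ) : ℂ) * (((β * (L : ℝ) ^ 2 : ℝ) : ℂ) * propCT L M β μ K p))‖
      ≤ (klScale klE0 n - klScale klE0 (n + 1)) * ((β * (L : ℝ) ^ 2) ^ 3)⁻¹ *
          ∑ p ∈ Wn, (β * (L : ℝ) ^ 2) ^ 2 * (128 / 3 / Λt ^ 2) * (|Φ j t p| * ‖propCT L M β μ K p‖) :=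
        mul_le_mul_of_nonneg_left (sum_le_sum fun p _ => hpt p) (by positivity)
    _ = (klScale klE0 n - klScale klE0 (n + 1)) * ((β * (L : ℝ) ^ 2) ^ 3)⁻¹ * ((β * (L : ℝ) ^ 2) ^ 2 * (128 / 3 / Λt ^ 2)) *
          ∑ p ∈ Wn, |Φ j t p| * ‖propCT L M β μ K p‖ := by
        rw [← Finset.mul_sum]; ring
    _ ≤ (klScale klE0 n - klScale klE0 (n + 1)) * ((β * (L : ℝ) ^ 2) ^ 3)⁻¹ * ((β * (L : ℝ) ^ 2) ^ 2 * (128 / 3 / Λt ^ 2)) *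
          (15381 * (ρ / π + ((L : ℝ))⁻¹) * klScale klE0 n * β * (L : ℝ) ^ 2) := mul_le_mul_of_nonneg_left hS (by positivity)
    _ = 128 / 3 * 15381 * (ρ / π + ((L : ℝ))⁻¹) * ((klScale klE0 n - klScale klE0 (n + 1)) * klScale klE0 n / Λt ^ 2) := by
        field_simp
    _ ≤ 128 / 3 * 15381 * (ρ / π + ((L : ℝ))⁻¹) * 12 :=
        mul_le_mul_of_nonneg_left (klpf_slice_ratio_le n ht) (by positivity)
    _ = (2 : ℝ) ^ 9 * 15381 * (ρ / π + ((L : ℝ))⁻¹) := by ring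

omit [NeZero M] in
/-- **THE MODULI PART WITH A PINNING PROFILE.**  For any kernel product `W`, `p`-independent `V₀`, and a profile (`ε ≥ 0`; `m` windows with centres `cen`, radii `ρ ≥ 0`,
heights `A ≥ 0`) with `‖W p σ − V₀ σ‖ ≤ ε + Σ_w 𝟙[‖k̃_p − cen w‖_𝕋 ≤ ρ w]·A w` wherever `Ẇ_t(p) ≠ 0`:
`(Λₙ−Λₙ₊₁)((βL²)³)⁻¹‖Σ_pΣ_σ(Ẇ_tβL²ĝ)(Φ_jβL²ĝ)·W p σ‖ ≤ (Λₙ−Λₙ₊₁)((βL²)³)⁻¹‖Σ_pΣ_σ(Ẇ_tβL²ĝ)(Φ_jβL²ĝ)·V₀ σ‖ + 2¹⁰·15367·ε + Σ_w 2¹⁰·15381·(ρ w/π + 1/L)·A w`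
(`FrameOK` frame, `klBetaMin ≤ β ≤ L`, `j ≥ n+1`, `t ∈ [0,1]`). [cite: BenfattoGiulianiMastropietro2006, §2.4–§2.5] -/
theorem klph_phValue_row_profile_le {β μ : ℝ} {K : TrigPolyC4v} (hK : FrameOK R U N μ K) (hβ : klBetaMin ≤ β) (hβL : β ≤ L) (n : ℕ) {t : ℝ}
    (ht : t ∈ Icc (0 : ℝ) 1)
    (Φ : ℕ → ℝ → FreqMomentum L M → ℝ)
    (hΦ : Φ = fun j t k => (softSymbolCompl L M β μ K (n + 1) j) k + (hubbardCutoffWeightCT L M β μ K (klScale klE0 (n + 1)) k -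
        hubbardCutoffWeightCT L M β μ K (klScale klE0 n + t * (klScale klE0 (n + 1) - klScale klE0 n)) k))
    (Wd : ℝ → FreqMomentum L M → ℝ)
    (hWd : Wd = fun t k => deriv (fun Λ' : ℝ => hubbardCutoffWeightCT L M β μ K Λ' k) (klScale klE0 n + t * (klScale klE0 (n + 1) - klScale klE0 n)))
    {j : ℕ} (hj : n + 1 ≤ j) (W : FreqMomentum L M → Fin 2 → ℂ) (V₀ : Fin 2 → ℂ) {ε : ℝ} (hε0 : 0 ≤ ε)
    {m : ℕ} (cen : Fin m → TorusSite 2 L) (ρ A : Fin m → ℝ) (hρ : ∀ w, 0 ≤ ρ w) (hA : ∀ w, 0 ≤ A w)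
    (hδ : ∀ p : FreqMomentum L M, ∀ σ : Fin 2, Wd t p ≠ 0 →
      ‖W p σ - V₀ σ‖ ≤ ε + ∑ w : Fin m, if klTorusNorm L (p.2 - cen w) ≤ ρ w then A w else 0) :
    (klScale klE0 n - klScale klE0 (n + 1)) * ((β * (L : ℝ) ^ 2) ^ 3)⁻¹ *
        ‖∑ p : FreqMomentum L M, ∑ σ : Fin 2,
          (((((Wd t p) : ℝ) : ℂ) * (((β * (L : ℝ) ^ 2 : ℝ) : ℂ) * propCT L M β μ K p)) * ((((Φ j t p) : ℝ) : ℂ) * (((β * (L : ℝ) ^ 2 : ℝ) : ℂ) * propCT L M β μ K p))) *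
            W p σ‖ ≤
      (klScale klE0 n - klScale klE0 (n + 1)) * ((β * (L : ℝ) ^ 2) ^ 3)⁻¹ *
          ‖∑ p : FreqMomentum L M, ∑ σ : Fin 2,
            (((((Wd t p) : ℝ) : ℂ) * (((β * (L : ℝ) ^ 2 : ℝ) : ℂ) * propCT L M β μ K p)) * ((((Φ j t p) : ℝ) : ℂ) * (((β * (L : ℝ) ^ 2 : ℝ) : ℂ) * propCT L M β μ K p))) *
              V₀ σ‖ +
        (2 : ℝ) ^ 10 * 15367 * ε + ∑ w : Fin m, (2 : ℝ) ^ 10 * 15381 * (ρ w / π + ((L : ℝ))⁻¹) * A w := by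
  classical
  have hβ0 : 0 < β := pos_of_klBetaMin_le hβ
  have hL : (0 : ℝ) < L := hβ0.trans_le hβL
  have hβL2 : 0 < β * (L : ℝ) ^ 2 := by positivity
  have h10 := (klmf_klScale_succ_pos_le n).2
  have hdiff : 0 ≤ klScale klE0 n - klScale klE0 (n + 1) := by linarith
  set C : ℝ := (klScale klE0 n - klScale klE0 (n + 1)) * ((β * (L : ℝ) ^ 2) ^ 3)⁻¹ with hC_def
  have hC : 0 ≤ C := by positivity
  set line : FreqMomentum L M → ℂ := fun p =>
    ((((Wd t p) : ℝ) : ℂ) * (((β * (L : ℝ) ^ 2 : ℝ) : ℂ) * propCT L M β μ K p)) * ((((Φ j t p) : ℝ) : ℂ) * (((β * (L : ℝ) ^ 2 : ℝ) : ℂ) * propCT L M β μ K p))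
    with hline_def
  set prof : FreqMomentum L M → ℝ := fun p => ε + ∑ w : Fin m, if klTorusNorm L (p.2 - cen w) ≤ ρ w then A w else 0 with hprof_def
  have hprof0 : ∀ p, 0 ≤ prof p := fun p => by
    have : 0 ≤ ∑ w : Fin m, (if klTorusNorm L (p.2 - cen w) ≤ ρ w then A w else 0) :=
      sum_nonneg fun w _ => by split_ifs <;> [exact hA w; exact le_rfl]
    simp only [hprof_def]; linarith
  -- split `W = V₀ + (W − V₀)`
  have hsplit : ∑ p : FreqMomentum L M, ∑ σ : Fin 2, line p * W p σ =
      (∑ p : FreqMomentum L M, ∑ σ : Fin 2, line p * V₀ σ) + ∑ p : FreqMomentum L M, ∑ σ : Fin 2, line p * (W p σ - V₀ σ) := by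
    rw [← sum_add_distrib]
    refine sum_congr rfl fun p _ => ?_
    rw [← sum_add_distrib]
    refine sum_congr rfl fun σ _ => ?_
    ring
  -- the moduli piece, termwise against the profile
  have hterm : ∀ p : FreqMomentum L M, ∀ σ : Fin 2, ‖line p * (W p σ - V₀ σ)‖ ≤ ‖line p‖ * prof p := by
    intro p σ
    rw [norm_mul]
    by_cases hp : Wd t p = 0
    · have : line p = 0 := by simp only [hline_def, hp, Complex.ofReal_zero, zero_mul]
      rw [this, norm_zero, zero_mul, zero_mul]
    · exact mul_le_mul_of_nonneg_left (hδ p σ hp) (norm_nonneg _)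
  have hmod : ‖∑ p : FreqMomentum L M, ∑ σ : Fin 2, line p * (W p σ - V₀ σ)‖ ≤ 2 * ∑ p : FreqMomentum L M, ‖line p‖ * prof p := by
    calc ‖∑ p : FreqMomentum L M, ∑ σ : Fin 2, line p * (W p σ - V₀ σ)‖
        ≤ ∑ p : FreqMomentum L M, ‖∑ σ : Fin 2, line p * (W p σ - V₀ σ)‖ := norm_sum_le _ _
      _ ≤ ∑ p : FreqMomentum L M, ∑ σ : Fin 2, ‖line p * (W p σ - V₀ σ)‖ := sum_le_sum fun p _ => norm_sum_le _ _
      _ ≤ ∑ p : FreqMomentum L M, ∑ σ : Fin 2, ‖line p‖ * prof p := sum_le_sum fun p _ => sum_le_sum fun σ _ => hterm p σ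
      _ = 2 * ∑ p : FreqMomentum L M, ‖line p‖ * prof p := by
          simp only [Fin.sum_univ_two, Finset.mul_sum]
          refine sum_congr rfl fun p _ => ?_
          ring
  -- expand the profile: `Σ_p ‖line p‖·prof p = ε·Σ_p ‖line p‖ + Σ_w A w·Σ_{p ∈ window w} ‖line p‖`
  have hexpand : ∑ p : FreqMomentum L M, ‖line p‖ * prof p =
      ε * ∑ p : FreqMomentum L M, ‖line p‖ +
        ∑ w : Fin m, A w * ∑ p ∈ (univ : Finset (FreqMomentum L M)).filter (fun p => klTorusNorm L (p.2 - cen w) ≤ ρ w), ‖line p‖ := by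
    simp only [hprof_def, mul_add, sum_add_distrib, Finset.mul_sum]
    congr 1
    · exact sum_congr rfl fun p _ => by ring
    · rw [Finset.sum_comm]
      refine sum_congr rfl fun w _ => ?_
      rw [Finset.sum_filter]
      refine sum_congr rfl fun p _ => ?_
      split_ifs <;> ring
  -- the two masses
  have hnl : ∀ p : FreqMomentum L M, ‖line p‖ =
      ‖((((Wd t p) : ℝ) : ℂ) * (((β * (L : ℝ) ^ 2 : ℝ) : ℂ) * propCT L M β μ K p))‖ *
        ‖((((Φ j t p) : ℝ) : ℂ) * (((β * (L : ℝ) ^ 2 : ℝ) : ℂ) * propCT L M β μ K p))‖ := fun p => norm_mul _ _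
  have hmass : C * ∑ p : FreqMomentum L M, ‖line p‖ ≤ (2 : ℝ) ^ 9 * 15367 := by
    simp only [hnl, hC_def]
    exact klph_sum_bornLines_norm_le (L := L) (M := M) hK hβ hβL n ht Φ hΦ Wd hWd hj
  have hwin : ∀ w : Fin m, C * ∑ p ∈ (univ : Finset (FreqMomentum L M)).filter (fun p => klTorusNorm L (p.2 - cen w) ≤ ρ w), ‖line p‖ ≤
      (2 : ℝ) ^ 9 * 15381 * (ρ w / π + ((L : ℝ))⁻¹) := by
    intro w
    simp only [hnl, hC_def]
    exact klph_sum_window_bornLines_norm_le (L := L) (M := M) hK hβ hβL n ht Φ hΦ Wd hWd hj (cen w) (hρ w)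
  have hprofmass : C * (2 * ∑ p : FreqMomentum L M, ‖line p‖ * prof p) ≤
      (2 : ℝ) ^ 10 * 15367 * ε + ∑ w : Fin m, (2 : ℝ) ^ 10 * 15381 * (ρ w / π + ((L : ℝ))⁻¹) * A w := by
    rw [hexpand]
    have h1 : C * (2 * (ε * ∑ p : FreqMomentum L M, ‖line p‖)) ≤ (2 : ℝ) ^ 10 * 15367 * ε := by
      have := mul_le_mul_of_nonneg_left hmass (by positivity : (0 : ℝ) ≤ 2 * ε)
      calc C * (2 * (ε * ∑ p : FreqMomentum L M, ‖line p‖)) = 2 * ε * (C * ∑ p : FreqMomentum L M, ‖line p‖) := by ring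
        _ ≤ 2 * ε * ((2 : ℝ) ^ 9 * 15367) := this
        _ = (2 : ℝ) ^ 10 * 15367 * ε := by ring
    have h2 : C * (2 * ∑ w : Fin m, A w * ∑ p ∈ (univ : Finset (FreqMomentum L M)).filter (fun p => klTorusNorm L (p.2 - cen w) ≤ ρ w), ‖line p‖) ≤
        ∑ w : Fin m, (2 : ℝ) ^ 10 * 15381 * (ρ w / π + ((L : ℝ))⁻¹) * A w := by
      rw [Finset.mul_sum, Finset.mul_sum]
      refine sum_le_sum fun w _ => ?_
      have := mul_le_mul_of_nonneg_left (hwin w) (by linarith [hA w] : (0 : ℝ) ≤ 2 * A w)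
      calc C * (2 * (A w * ∑ p ∈ (univ : Finset (FreqMomentum L M)).filter (fun p => klTorusNorm L (p.2 - cen w) ≤ ρ w), ‖line p‖))
          = 2 * A w * (C * ∑ p ∈ (univ : Finset (FreqMomentum L M)).filter (fun p => klTorusNorm L (p.2 - cen w) ≤ ρ w), ‖line p‖) := by ring
        _ ≤ 2 * A w * ((2 : ℝ) ^ 9 * 15381 * (ρ w / π + ((L : ℝ))⁻¹)) := this
        _ = (2 : ℝ) ^ 10 * 15381 * (ρ w / π + ((L : ℝ))⁻¹) * A w := by ring
    calc C * (2 * (ε * ∑ p : FreqMomentum L M, ‖line p‖ +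
          ∑ w : Fin m, A w * ∑ p ∈ (univ : Finset (FreqMomentum L M)).filter (fun p => klTorusNorm L (p.2 - cen w) ≤ ρ w), ‖line p‖))
        = C * (2 * (ε * ∑ p : FreqMomentum L M, ‖line p‖)) +
          C * (2 * ∑ w : Fin m, A w * ∑ p ∈ (univ : Finset (FreqMomentum L M)).filter (fun p => klTorusNorm L (p.2 - cen w) ≤ ρ w), ‖line p‖) := by ring
      _ ≤ _ := add_le_add h1 h2
  -- assemble
  calc C * ‖∑ p : FreqMomentum L M, ∑ σ : Fin 2, line p * W p σ‖
      = C * ‖(∑ p : FreqMomentum L M, ∑ σ : Fin 2, line p * V₀ σ) + ∑ p : FreqMomentum L M, ∑ σ : Fin 2, line p * (W p σ - V₀ σ)‖ := by rw [hsplit]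
    _ ≤ C * (‖∑ p : FreqMomentum L M, ∑ σ : Fin 2, line p * V₀ σ‖ + 2 * ∑ p : FreqMomentum L M, ‖line p‖ * prof p) :=
        mul_le_mul_of_nonneg_left ((norm_add_le _ _).trans (by linarith [hmod])) hC
    _ = C * ‖∑ p : FreqMomentum L M, ∑ σ : Fin 2, line p * V₀ σ‖ + C * (2 * ∑ p : FreqMomentum L M, ‖line p‖ * prof p) := by ring
    _ ≤ C * ‖∑ p : FreqMomentum L M, ∑ σ : Fin 2, line p * V₀ σ‖ +
        ((2 : ℝ) ^ 10 * 15367 * ε + ∑ w : Fin m, (2 : ℝ) ^ 10 * 15381 * (ρ w / π + ((L : ℝ))⁻¹) * A w) := by linarith [hprofmass]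
    _ = _ := by ring

end Profile

end Summit.HubbardSuperconductivity.HubbardSuperconductivity.Theorems.KLRegimeSplit

end
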